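import Summits.QuantumFields.YangMills.Theorems.BalabanUVNodesN12Thm1NamesOfGridGStepTokensB
import Summits.QuantumFields.YangMills.Theorems.BalabanUVNodesK0Stub1BHolds
import HarnessLib

/-!
# BalabanUVNodes ∕ N12 — THE (R)-NAME OF [15] THEOREM 1 AT K0⁷'s GRID GUARD, AT PRINT's [II] (2.3) DATUM, IS INHABITED; THE (E∕U)-NAME THERE ⟸ STEPᴮ ∕ SUPPLYᴮ ∕ LIFTᴮ ONLY
# ([Balaban1985Variational] Thm 1 (8) p.279, (11)–(14) pp.279–280, Prop. 2 p.281, Prop. 8 p.304; [Balaban1984PropagatorsII] (2.3) p.224; [Balaban1985RegularSpaces] (1.3)–(1.6) p.77; [Balaban1988Convergent] (2.12) p.256, (2.18) p.257)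

Cell `pub-ymgap` (HUMAN RULINGS D-0062 ∕ D-0149), seat `pub-ymgap-dag-n12-d` g31 (R134 N12 [B15] s2 = by-name knit at the record; count-neutral helper of K1⁹ `stmt-QuantumFields-27364`,
`--kind proof --supports … --as helper`).  THEOREMS ONLY (0 `def`, 0 `instance`, 0 `sorry`); composition BY NAME.  INTENT-112 of 2026-08-30.

WHY.  N12's junction of record «12Q-DIRECT v14ᴸ» (#10983) and its K0⁷-currency pointers L5∕L6∕L7 (#10975∕#10981∕#10982) display the two [15]-Theorem-1 names as HYPOTHESES — `h15`
(regularity, (8)) and `h15EU` ((E∕U)) — «INHABITED BY: nobody» since the day they were typed.  Today the (E1)∕(iii-b) programme moved the K0 road to print's [II] (2.3) datum and CLOSED its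
chart side: dag-n07-e g34's `K0Stub1BHolds.prop8StepCoPGridGBAt_holds (F) : K0V23Defs.Prop8StepCoPGridGBAt F` (✓, 09:33Z; the S1c chain `exists_prop8RegSepTopStepGB_lam F 1 le_rfl` ✓p767364 over
dag-n05-e's record crown) is [15] Proposition 8's grid-guarded top step at `(lamDatum F, dataSmall7LamTopOf F 2)` for EVERY `F : T4Family`, HYPOTHESIS-FREE.  This seat's 111 ✓p767389 §4
`thm1NamesB_grid_lamDatum_of_prop8StepGB_of_stepTokensB` turns exactly that text's BODY into both names ᴮ at K0⁷'s grid guard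
`A‴(c,c₀,c₁) := fun ν M g K k _s => c ≤ ν.M₁ ∧ k + c₀ ≤ F.m + K ∧ F.L^{c₁} ∣ M ∧ ∀ i, 1 ≤ i → i ≤ k → dCubeSide (F.P K).L M (RkOfRecord (F.P K).L ν.r (g i)) i ∣ (F.P K).sitesPerDir 0`.
THIS FILE composes the two: for every `F`, the (R)-NAME ᴮ `Node00.VariationalThm1RegSepCoP7MGB F 2 A‴ (lamDatum F) (dataSmall7LamTopOf F 2) B₃ a₀ a₁` IS INHABITED for some stub constants
`(c, c₀, c₁, B₃, a₀, a₁)` with `2L² ≤ B₃`, `0 < a₀`, `0 < a₁` (§1) — the FIRST [15]-Theorem-1 name of N12's road with a PRODUCER, at print's datum and K0⁷'s V23 currency — and the (E∕U)-NAME ᴮ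
there follows from dag-n12-c's three producer-shaped tokens ᴮ ALONE (STEPᴮ at `A‴`, SUPPLYᴮ at `A‴ ∧ k = 1`, LIFTᴮ at `A‴`; §2): the `h1` binder of 111 §4 is DISCHARGED.

WHAT THIS FILE PROVES.  §1 ★★★★ `thm1RegNameB_grid_lamDatum_inhabited (F)` — HYPOTHESIS-FREE: `∃ (c c₀ c₁) (B₃ a₀ a₁), 2L² ≤ B₃ ∧ 0 < a₀ ∧ 0 < a₁ ∧ VariationalThm1RegSepCoP7MGB F 2 A‴ (lamDatum F)
(dataSmall7LamTopOf F 2) B₃ a₀ a₁` (k0-s1-w1's 53′ bridge `variationalThm1RegSepCoP7MGB_of_prop8TopStepGB_lamDatum` ∘ `prop8StepCoPGridGBAt_holds`).  §2 ★★★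
`thm1NamesB_grid_lamDatum_of_stepTokensB (F)` — ∃ the same constants with the (R)-name ᴮ AND, for every `C₁`, STEPᴮ → SUPPLYᴮ → LIFTᴮ → the (E∕U)-name ᴮ
`B11Thm1ExistsUniqueTokensGB.VariationalThm1EUSepCoP7MGB F 2 A‴ (lamDatum F) (dataSmall7LamTopOf F 2) B₃ a₀ a₁` (111 §4 at `h1 := prop8StepCoPGridGBAt_holds F`).

HONEST FRAMING.  By-name composition of LANDED theorems; §1 is UNCONDITIONAL (standard axioms; its content is the S1c chain's and the 53′∕F0 twins'), §2 is CONDITIONAL on the three tokens ᴮ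
(no producer for any of them at any datum — [15] (11)–(14), Prop. 2 remain N07∕NODE-00 obligations).  WHAT THIS IS NOT: not a discharge of `h15`∕`h15EU` AS DISPLAYED by v14ᴸ∕L5∕L7 — those
read the (b)-instance names at the (b)-background (`genSetDatum`, `bgMSCoPOfRecord`); the names inhabited here are the ᴮ names at PRINT's datum at K0⁷'s grid guard, which the junction's ᴮ
re-key (dag-n12-c's `N12-REATTACHMENT-DESIGN-2026-08-30.md`, this lineage's Theorems twins) will display; until then this is an «INHABITED BY» certificate for the road-to-be, count-neutral.
K0⁷ is NOT closed by this (V23 registration + stub 3ᴬ′ᴮ + the seam are the plan's∕K0 lane's); `stmt-QuantumFields-20541` ∕ K1⁹ OPEN; N12 NOT discharged; counts unmoved (typed 28∕28 ·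
discharged 8∕28, 8∕27 excl. NODE O); red-by-CLOSURE in the Stage-2 window (imports 111 → 110 → `K0V22ZDefs`, and `K0Stub1BHolds` → `K0V23Defs`), green before∕after, zero text change; one
finite 𝕋⁴ programme at fixed `ε = L^{-K}` — R4 closes only the conditional rung `BalabanLadder.UV`; nothing continuum ∕ ℝ⁴ ∕ OS; the Yang–Mills mass gap (Clay) is NOT proved by any of this.
-/

noncomputable section

namespace Summit.QuantumFields.YangMills.BalabanUVNodes.N12Thm1NamesBInhabitedAtGridGuardLam

open Literature.MathematicalPhysics.QuantumFieldTheory.Balaban1983to89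
open Literature.MathematicalPhysics.QuantumFieldTheory.Balaban1983to89.Node00
open Literature.MathematicalPhysics.QuantumFieldTheory.Balaban1983to89.T4Continuum
open B11Thm1ExistsUniqueTokensGB (VariationalThm1EUSepCoP7MGB VariationalThm1EUStepCoP7MGB ApproxMinimiserExistsCoP7MGB VariationalThm1EULiftCoP7MGB)
open Summit.QuantumFields.YangMills.BalabanUVNodes.N07Thm1Top7FromProp8GuardedB (variationalThm1RegSepCoP7MGB_of_prop8TopStepGB_lamDatum)
open Summit.QuantumFields.YangMills.BalabanUVNodes.N12Thm1NamesOfGridGStepTokensB (thm1NamesB_grid_lamDatum_of_prop8StepGB_of_stepTokensB)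
open Summit.QuantumFields.YangMills.BalabanUVNodes.K0Stub1BHolds (prop8StepCoPGridGBAt_holds)

/-! ## §1  The (R)-name ᴮ at K0⁷'s grid guard, at print's datum — INHABITED -/

/-- ★★★★ **[15] THEOREM 1, REGULARITY HALF (8), AT PRINT's [II] (2.3) DATUM AND K0⁷'s GRID GUARD — INHABITED** (`N = 2`, every `F : T4Family`, HYPOTHESIS-FREE): there are stub constants
`(c, c₀, c₁, B₃, a₀, a₁)` with `2L² ≤ B₃`, `0 < a₀`, `0 < a₁` such that `Node00.VariationalThm1RegSepCoP7MGB F 2 A‴(c,c₀,c₁) (lamDatum F) (dataSmall7LamTopOf F 2) B₃ a₀ a₁` holds — k0-s1-w1's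
53′ bridge ((8)ᴮ from Prop. 8's guarded top step ᴮ at `lamDatum`) applied to dag-n07-e's CLOSED V23 stub-1 text `K0Stub1BHolds.prop8StepCoPGridGBAt_holds F`.  The first [15]-Theorem-1 name of
N12's road with a producer. [cite: Balaban1985Variational, Thm 1 (8) p.279, Prop. 8 p.304; Balaban1984PropagatorsII, (2.3) p.224; Balaban1988Convergent, (2.12) p.256, (2.18) p.257] -/
theorem thm1RegNameB_grid_lamDatum_inhabited (F : T4Family) :
    ∃ (c c₀ c₁ : ℕ) (B₃ a₀ a₁ : ℝ), 2 * (F.L : ℝ) ^ 2 ≤ B₃ ∧ 0 < a₀ ∧ 0 < a₁ ∧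
      VariationalThm1RegSepCoP7MGB F 2
        (fun ν M g K k _s => c ≤ ν.M₁ ∧ k + c₀ ≤ F.m + K ∧ F.L ^ c₁ ∣ M ∧
          ∀ i, 1 ≤ i → i ≤ k → dCubeSide (F.P K).L M (RkOfRecord (F.P K).L ν.r (g i)) i ∣ (F.P K).sitesPerDir 0) (lamDatum F) (dataSmall7LamTopOf F 2) B₃ a₀ a₁ := by
  obtain ⟨c, c₀, c₁, B₃, a₀, a₁, hB₃, ha₀, ha₁, h8⟩ := prop8StepCoPGridGBAt_holds F
  have hL : (0 : ℝ) < F.L := by exact_mod_cast (show 0 < F.L by have := F.hL.2; omega)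
  have hB : 0 < B₃ := lt_of_lt_of_le (by positivity) hB₃
  exact ⟨c, c₀, c₁, B₃, a₀, a₁, hB₃, ha₀, ha₁, variationalThm1RegSepCoP7MGB_of_prop8TopStepGB_lamDatum hB h8⟩

/-! ## §2  Both names ᴮ there from the three tokens ᴮ alone -/

/-- ★★★ **BOTH [15]-THEOREM-1 NAMES ᴮ AT K0⁷'s GRID GUARD, AT PRINT's DATUM, FROM STEPᴮ ∕ SUPPLYᴮ ∕ LIFTᴮ ALONE** (`N = 2`, every `F`): ∃ the stub's constants with the (R)-name ᴮ (§1) — AND,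
for every `C₁`, dag-n12-c's one-length STEP token ᴮ at `A‴` → length-1 SUPPLY token ᴮ at `A‴ ∧ k = 1` → LIFT token ᴮ at `A‴` → the (E∕U)-name ᴮ at `A‴`: this seat's 111 §4 with its stub-1
binder DISCHARGED by `K0Stub1BHolds.prop8StepCoPGridGBAt_holds F`.  CONDITIONAL on the three tokens only (no producer for any of them). [cite: Balaban1985Variational, Thm 1 p.279, (11)–(14) pp.279–280, Prop. 2 p.281, Prop. 8 p.304; Balaban1984PropagatorsII, (2.3) p.224; Balaban1985RegularSpaces, (1.3)–(1.6) p.77; Balaban1988Convergent, (2.12) p.256, (2.18) p.257] -/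
theorem thm1NamesB_grid_lamDatum_of_stepTokensB (F : T4Family) :
    ∃ (c c₀ c₁ : ℕ) (B₃ a₀ a₁ : ℝ), 2 * (F.L : ℝ) ^ 2 ≤ B₃ ∧ 0 < a₀ ∧ 0 < a₁ ∧
      VariationalThm1RegSepCoP7MGB F 2
        (fun ν M g K k _s => c ≤ ν.M₁ ∧ k + c₀ ≤ F.m + K ∧ F.L ^ c₁ ∣ M ∧
          ∀ i, 1 ≤ i → i ≤ k → dCubeSide (F.P K).L M (RkOfRecord (F.P K).L ν.r (g i)) i ∣ (F.P K).sitesPerDir 0) (lamDatum F) (dataSmall7LamTopOf F 2) B₃ a₀ a₁ ∧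
      ∀ C₁ : ℝ,
        VariationalThm1EUStepCoP7MGB F 2
          (fun ν M g K k _s => c ≤ ν.M₁ ∧ k + c₀ ≤ F.m + K ∧ F.L ^ c₁ ∣ M ∧
            ∀ i, 1 ≤ i → i ≤ k → dCubeSide (F.P K).L M (RkOfRecord (F.P K).L ν.r (g i)) i ∣ (F.P K).sitesPerDir 0) (lamDatum F) (dataSmall7LamTopOf F 2) C₁ B₃ a₀ a₁ →
        ApproxMinimiserExistsCoP7MGB F 2
          (fun ν M g K k _s => (c ≤ ν.M₁ ∧ k + c₀ ≤ F.m + K ∧ F.L ^ c₁ ∣ M ∧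
            ∀ i, 1 ≤ i → i ≤ k → dCubeSide (F.P K).L M (RkOfRecord (F.P K).L ν.r (g i)) i ∣ (F.P K).sitesPerDir 0) ∧ k = 1) (lamDatum F) (dataSmall7LamTopOf F 2) C₁ B₃ a₀ a₁ →
        VariationalThm1EULiftCoP7MGB F 2
          (fun ν M g K k _s => c ≤ ν.M₁ ∧ k + c₀ ≤ F.m + K ∧ F.L ^ c₁ ∣ M ∧
            ∀ i, 1 ≤ i → i ≤ k → dCubeSide (F.P K).L M (RkOfRecord (F.P K).L ν.r (g i)) i ∣ (F.P K).sitesPerDir 0) (lamDatum F) (dataSmall7LamTopOf F 2) C₁ B₃ a₀ a₁ →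
        VariationalThm1EUSepCoP7MGB F 2
          (fun ν M g K k _s => c ≤ ν.M₁ ∧ k + c₀ ≤ F.m + K ∧ F.L ^ c₁ ∣ M ∧
            ∀ i, 1 ≤ i → i ≤ k → dCubeSide (F.P K).L M (RkOfRecord (F.P K).L ν.r (g i)) i ∣ (F.P K).sitesPerDir 0) (lamDatum F) (dataSmall7LamTopOf F 2) B₃ a₀ a₁ :=
  thm1NamesB_grid_lamDatum_of_prop8StepGB_of_stepTokensB (prop8StepCoPGridGBAt_holds F)

end Summit.QuantumFields.YangMills.BalabanUVNodes.N12Thm1NamesBInhabitedAtGridGuardLam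

end
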